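import Mathlib.GroupTheory.Nilpotent
import Mathlib.Data.List.OfFn
import HarnessLib

/-!
# Polynomial growth of finitely generated nilpotent groups (Wolf 1968), I: commutator collection

J. A. Wolf, *Growth of finitely generated solvable groups and curvature of Riemannian manifolds*,
J. Differential Geometry 2 (1968) 421–446, §3 (proof of Theorem 3.2): in a nilpotent group every word
in finitely many generators can be rewritten ("collected") as a product of powers of the generators
times a word in iterated commutators, the number of letters of each commutator weight growing only
polynomially in the length of the word.  (Also H. Bass, Proc. LMS 25 (1972) 603–614, §2.)

This file is the purely combinatorial half, stated for an ABSTRACT letter evaluation: letters are pairs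
`(l, b) : List ι × ι` ("right-normed commutators `[x_{l₁}⁻¹, [x_{l₂}⁻¹, …, x_b]]`", weight `l.length + 1`),
`φ` evaluates them in a group `G`, `x : ι → G` are the generators, and the only facts used are the
swap identity `φ (l,b) · x a = x a · φ (a :: l, b) · φ (l, b)` (`u y = y [y⁻¹,u] u`) and the vanishing
of letters of weight `> c` (nilpotency).  File II (`PolynomialGrowthNilpotent`) instantiates `φ` with the
iterated commutator and derives polynomial growth.

* §1 passing one generator through a word (`exists_pass`);
* §2 collecting all occurrences of one generator (`exists_collect`), with the count of letters of each
  weight bounded by `|W|·(|W|+1)^m`;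
* §3 collecting a list of generators in turn (`exists_collect_list`).

Topic `Literature/GroupTheory/Nilpotent`, namespace `Literature.GroupTheory.Nilpotent`.  Theorems only
(no `def`/`instance`/notation).  Lane `prim-bschramm`, seat p3 (class C2): this is the input that removes the
polynomial-growth HYPOTHESIS from the lane's virtually-nilpotent Cayley-graph corollaries.
-/

namespace Literature.GroupTheory.Nilpotent

variable {G : Type*} [Group G] {ι : Type*}

/-! ## §1 Passing one generator through a word -/

/-- **One generator passes through a collected word** (Wolf 1968, §3): if `u y = y·β(u)·u` for every letter
`u` (with `β(u)` of weight one more, and letters of weight `> c` trivial), then `W · y = y · W'` where `W'`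
is `W` with one new letter inserted after each letter of weight `< c`; the weight-`1` letters of `W'` are
those of `W`, and for each `m` the number of letters of weight `m+2` grows by at most the number of letters
of weight `m+1`. [cite: WolfGrowth1968, §3 (proof of Thm. 3.2)] -/
theorem exists_pass (φ : List ι × ι → G) (x : ι → G) (c : ℕ)
    (hswap : ∀ (l : List ι) (b a : ι), φ (l, b) * x a = x a * φ (a :: l, b) * φ (l, b))
    (hvan : ∀ (l : List ι) (b : ι), c ≤ l.length → φ (l, b) = 1) (a : ι)
    (W : List (List ι × ι)) (hW : ∀ p ∈ W, p.1.length < c) :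
    ∃ W' : List (List ι × ι),
      (W.map φ).prod * x a = x a * (W'.map φ).prod ∧
      (∀ p ∈ W', p.1.length < c) ∧
      (∀ p ∈ W', p.1.length = 0 → p ∈ W) ∧
      W'.countP (fun p => p.1.length = 0) = W.countP (fun p => p.1.length = 0) ∧
      ∀ m : ℕ, W'.countP (fun p => p.1.length = m + 1) ≤
        W.countP (fun p => p.1.length = m + 1) + W.countP (fun p => p.1.length = m) := by
  induction W with
  | nil =>
    refine ⟨[], by simp, by simp, by simp, by simp, fun m => by simp⟩
  | cons u W ih =>
    obtain ⟨W', hprod, hlt, hmem, h0, hsucc⟩ := ih (fun p hp => hW p (List.mem_cons_of_mem u hp))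
    have hu : u.1.length < c := hW u (List.mem_cons_self)
    by_cases hc : u.1.length + 1 < c
    · -- keep the new letter `β u = (a :: u.1, u.2)`
      refine ⟨(a :: u.1, u.2) :: u :: W', ?_, ?_, ?_, ?_, ?_⟩
      · rw [List.map_cons, List.prod_cons, mul_assoc, hprod, ← mul_assoc, hswap u.1 u.2 a]
        simp only [List.map_cons, List.prod_cons, mul_assoc]
      · intro p hp
        simp only [List.mem_cons] at hp
        rcases hp with rfl | rfl | hp
        · simpa using hc
        · exact hu
        · exact hlt p hp
      · intro p hp hp0
        simp only [List.mem_cons] at hp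
        rcases hp with rfl | rfl | hp
        · simp at hp0
        · exact List.mem_cons_self
        · exact List.mem_cons_of_mem u (hmem p hp hp0)
      · rw [List.countP_cons, List.countP_cons, List.countP_cons, h0]
        simp
      · intro m
        have h := hsucc m
        simp only [List.countP_cons, List.length_cons] at h ⊢
        by_cases h1 : u.1.length = m + 1 <;> by_cases h2 : u.1.length = m <;> simp [h1, h2] at h ⊢ <;> omega
    · -- the new letter has weight `> c`: it is trivial
      have hce : c ≤ (a :: u.1).length := by simp only [List.length_cons]; omega
      refine ⟨u :: W', ?_, ?_, ?_, ?_, ?_⟩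
      · rw [List.map_cons, List.prod_cons, mul_assoc, hprod, ← mul_assoc, hswap u.1 u.2 a, hvan _ _ hce, mul_one]
        simp only [List.map_cons, List.prod_cons, mul_assoc]
      · intro p hp
        simp only [List.mem_cons] at hp
        rcases hp with rfl | hp
        · exact hu
        · exact hlt p hp
      · intro p hp hp0
        simp only [List.mem_cons] at hp
        rcases hp with rfl | hp
        · exact List.mem_cons_self
        · exact List.mem_cons_of_mem u (hmem p hp hp0)
      · rw [List.countP_cons, List.countP_cons, h0]
      · intro m
        have h := hsucc m
        simp only [List.countP_cons] at h ⊢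
        by_cases h1 : u.1.length = m + 1 <;> by_cases h2 : u.1.length = m <;> simp [h1, h2] at h ⊢ <;> omega

/-! ## §2 Collecting all occurrences of one generator -/

/-- **Collecting one generator** (Wolf 1968, §3): every word `W` in letters of weight `≤ c` equals
`(x a)^e · W'` where `W'` contains no weight-`1` letter `a`, every weight-`1` letter of `W'` is one of `W`,
`e` plus the number of weight-`1` letters of `W'` is at most the number of weight-`1` letters of `W`, and for
every `m` the number of letters of `W'` of weight `m+1` is at most `|W|·(|W|+1)^m`.
[cite: WolfGrowth1968, §3 (proof of Thm. 3.2)] -/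
theorem exists_collect (φ : List ι × ι → G) (x : ι → G) (c : ℕ)
    (hswap : ∀ (l : List ι) (b a : ι), φ (l, b) * x a = x a * φ (a :: l, b) * φ (l, b))
    (hvan : ∀ (l : List ι) (b : ι), c ≤ l.length → φ (l, b) = 1) (a : ι) (hφa : φ ([], a) = x a)
    (W : List (List ι × ι)) (hW : ∀ p ∈ W, p.1.length < c) :
    ∃ (e : ℕ) (W' : List (List ι × ι)),
      (W.map φ).prod = x a ^ e * (W'.map φ).prod ∧
      (∀ p ∈ W', p.1.length < c) ∧ ([], a) ∉ W' ∧
      (∀ p ∈ W', p.1.length = 0 → p ∈ W) ∧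
      e + W'.countP (fun p => p.1.length = 0) ≤ W.countP (fun p => p.1.length = 0) ∧
      ∀ m : ℕ, W'.countP (fun p => p.1.length = m) ≤ W.length * (W.length + 1) ^ m := by
  induction W using List.reverseRecOn with
  | nil =>
    exact ⟨0, [], by simp, by simp, by simp, by simp, by simp, fun m => by simp⟩
  | append_singleton W₀ p ih =>
    obtain ⟨e₀, W₀', hprod, hlt, hna, hmem, hcnt, hbd⟩ :=
      ih (fun q hq => hW q (List.mem_append_left _ hq))
    have hp : p.1.length < c := hW p (List.mem_append_right _ (List.mem_singleton_self p))
    -- arithmetic for the bounds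
    have key : ∀ m : ℕ, W₀.length * (W₀.length + 1) ^ (m + 1) + W₀.length * (W₀.length + 1) ^ m ≤
        (W₀.length + 1) * (W₀.length + 1 + 1) ^ (m + 1) := by
      intro m
      have h1 : (W₀.length + 1) ^ m ≤ (W₀.length + 1 + 1) ^ m := Nat.pow_le_pow_left (by omega) m
      calc W₀.length * (W₀.length + 1) ^ (m + 1) + W₀.length * (W₀.length + 1) ^ m
          = W₀.length * ((W₀.length + 1) ^ m * (W₀.length + 1 + 1)) := by ring
        _ ≤ (W₀.length + 1) * ((W₀.length + 1 + 1) ^ m * (W₀.length + 1 + 1)) := by gcongr; omega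
        _ = (W₀.length + 1) * (W₀.length + 1 + 1) ^ (m + 1) := by ring
    have key0 : ∀ m : ℕ, W₀.length * (W₀.length + 1) ^ m + 1 ≤ (W₀.length + 1) * (W₀.length + 1 + 1) ^ m := by
      intro m
      have h1 : (W₀.length + 1) ^ m ≤ (W₀.length + 1 + 1) ^ m := Nat.pow_le_pow_left (by omega) m
      have h2 : 1 ≤ (W₀.length + 1 + 1) ^ m := Nat.one_le_pow _ _ (by omega)
      nlinarith
    by_cases hpa : p = ([], a)
    · -- the last letter is the generator: pass it through the collected word
      subst hpa
      obtain ⟨W'', hpass, hlt', hmem', h0', hsucc'⟩ := exists_pass φ x c hswap hvan a W₀' hlt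
      refine ⟨e₀ + 1, W'', ?_, hlt', ?_, ?_, ?_, ?_⟩
      · rw [List.map_append, List.prod_append, hprod, List.map_singleton, List.prod_singleton, hφa, mul_assoc,
          hpass, ← mul_assoc, pow_succ]
      · intro hmemW
        exact hna (hmem' _ hmemW rfl)
      · intro q hq hq0
        exact List.mem_append_left _ (hmem q (hmem' q hq hq0) hq0)
      · have h1 : List.countP (fun p : List ι × ι => decide (p.1.length = 0)) [(([] : List ι), a)] = 1 := by simp
        rw [h0', List.countP_append, h1]
        omega
      · intro m
        simp only [List.length_append, List.length_singleton]
        cases m with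
        | zero => rw [h0']; exact (hbd 0).trans (by have := key0 0; simp only [pow_zero, mul_one] at this ⊢; omega)
        | succ m => exact (hsucc' m).trans (((add_le_add (hbd (m + 1)) (hbd m))).trans (key m))
    · -- the last letter stays at the end
      refine ⟨e₀, W₀' ++ [p], ?_, ?_, ?_, ?_, ?_, ?_⟩
      · rw [List.map_append, List.prod_append, hprod, List.map_append, List.prod_append, mul_assoc]
      · intro q hq
        rw [List.mem_append, List.mem_singleton] at hq
        rcases hq with hq | rfl
        · exact hlt q hq
        · exact hp
      · rw [List.mem_append, List.mem_singleton, not_or]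
        exact ⟨hna, fun h => hpa h.symm⟩
      · intro q hq hq0
        rw [List.mem_append, List.mem_singleton] at hq
        rcases hq with hq | rfl
        · exact List.mem_append_left _ (hmem q hq hq0)
        · exact List.mem_append_right _ (List.mem_singleton_self _)
      · rw [List.countP_append, List.countP_append]
        simp only [List.countP_singleton]
        split <;> omega
      · intro m
        rw [List.countP_append]
        simp only [List.countP_singleton, List.length_append, List.length_singleton]
        have := hbd m
        split <;> [exact (add_le_add this le_rfl).trans (key0 m); exact (this.trans (by have := key0 m; omega))]

/-! ## §3 Collecting a list of generators in turn -/

/-- Splitting a count by one more weight. [folklore] -/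
private theorem countP_length_lt_succ (U : List (List ι × ι)) (k : ℕ) :
    U.countP (fun p => p.1.length < k + 1) = U.countP (fun p => p.1.length < k) + U.countP (fun p => p.1.length = k) := by
  induction U with
  | nil => simp
  | cons q U ih =>
    rw [List.countP_cons, List.countP_cons, List.countP_cons, ih]
    by_cases h1 : q.1.length < k
    · have h2 : ¬ q.1.length = k := by omega
      have h3 : q.1.length < k + 1 := by omega
      rw [if_pos (by simpa using h3), if_pos (by simpa using h1), if_neg (by simpa using h2)]
      omega
    · by_cases h2 : q.1.length = k
      · have h3 : q.1.length < k + 1 := by omega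
        rw [if_pos (by simpa using h3), if_neg (by simpa using h1), if_pos (by simpa using h2)]
        omega
      · have h3 : ¬ q.1.length < k + 1 := by omega
        rw [if_neg (by simpa using h3), if_neg (by simpa using h1), if_neg (by simpa using h2)]
        omega

/-- A word in letters of weight `≤ c` with at most `B` letters of each weight has length `≤ c·B`. [folklore] -/
private theorem length_le_of_countP_le (c : ℕ) (V : List (List ι × ι)) (B : ℕ) (hV : ∀ p ∈ V, p.1.length < c)
    (hB : ∀ m, V.countP (fun p => p.1.length = m) ≤ B) : V.length ≤ c * B := by
  have hgen : ∀ k : ℕ, V.countP (fun p => p.1.length < k) ≤ k * B := by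
    intro k
    induction k with
    | zero => simp
    | succ k ih =>
      rw [countP_length_lt_succ]
      have := hB k
      nlinarith [ih]
  have hall : V.countP (fun p => p.1.length < c) = V.length := by
    rw [List.countP_eq_length]
    intro p hp
    simpa using hV p hp
  have := hgen c
  rwa [hall] at this

/-- **Collecting a list of generators** (Wolf 1968, §3): for every list `as` of `d` generators, every word
`W` in letters of weight `≤ c` equals `(x a₁)^{e₁} ⋯ (x a_d)^{e_d} · W'` (in the order of `as`) where `W'`
has no weight-`1` letter from `as`, every weight-`1` letter of `W'` is one of `W` and there are no more of
them than in `W`, each `eᵢ ≤ |W|`, and `|W'| ≤ A·(|W|+1)^E` for constants `A, E` depending only on `c`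
and `d`. [cite: WolfGrowth1968, §3 (proof of Thm. 3.2)] -/
theorem exists_collect_list (φ : List ι × ι → G) (x : ι → G) (c : ℕ)
    (hswap : ∀ (l : List ι) (b a : ι), φ (l, b) * x a = x a * φ (a :: l, b) * φ (l, b))
    (hvan : ∀ (l : List ι) (b : ι), c ≤ l.length → φ (l, b) = 1) (hφ : ∀ a, φ ([], a) = x a) (d : ℕ) :
    ∃ A E : ℕ, ∀ (as : List ι), as.length = d → ∀ (W : List (List ι × ι)), (∀ p ∈ W, p.1.length < c) →
      ∃ (es : List ℕ) (W' : List (List ι × ι)),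
        es.length = as.length ∧ (∀ e ∈ es, e ≤ W.length) ∧
        (W.map φ).prod = (List.zipWith (fun a e => x a ^ e) as es).prod * (W'.map φ).prod ∧
        (∀ p ∈ W', p.1.length < c) ∧ (∀ a ∈ as, ([], a) ∉ W') ∧
        (∀ p ∈ W', p.1.length = 0 → p ∈ W) ∧
        W'.countP (fun p => p.1.length = 0) ≤ W.countP (fun p => p.1.length = 0) ∧
        W'.length ≤ A * (W.length + 1) ^ E := by
  induction d with
  | zero =>
    refine ⟨1, 1, fun as has W hW => ?_⟩
    rw [List.length_eq_zero_iff] at has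
    subst has
    exact ⟨[], W, rfl, by simp, by simp, hW, by simp, fun p hp _ => hp, le_rfl, by nlinarith⟩
  | succ d ih =>
    obtain ⟨A, E, hAE⟩ := ih
    refine ⟨c * (A + 1) ^ c, E * c, fun as has W hW => ?_⟩
    obtain ⟨as₀, a, rfl⟩ : ∃ as₀ a, as = as₀ ++ [a] := by
      cases as using List.reverseRecOn with
      | nil => simp at has
      | append_singleton as₀ a => exact ⟨as₀, a, rfl⟩
    rw [List.length_append, List.length_singleton, Nat.add_right_cancel_iff] at has
    obtain ⟨es, V, hes, hesb, hprod, hlt, hnot, hmem, hcnt0, hVlen⟩ := hAE as₀ has W hW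
    obtain ⟨e, W', hprod', hlt', hna, hmem', hcnt, hbd⟩ := exists_collect φ x c hswap hvan a (hφ a) V hlt
    refine ⟨es ++ [e], W', by simp [hes], ?_, ?_, hlt', ?_, ?_, ?_, ?_⟩
    · intro e' he'
      rw [List.mem_append, List.mem_singleton] at he'
      rcases he' with he' | he'
      · exact hesb e' he'
      · rw [he']
        have h2 : V.countP (fun p => p.1.length = 0) ≤ W.length := hcnt0.trans List.countP_le_length
        omega
    · rw [hprod, hprod', List.zipWith_append hes.symm, List.prod_append]
      simp only [List.zipWith_cons_cons, List.zipWith_nil_right, List.prod_cons, List.prod_nil, mul_one, mul_assoc]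
    · intro a' ha'
      rw [List.mem_append, List.mem_singleton] at ha'
      rcases ha' with ha' | ha'
      · exact fun h => hnot a' ha' (hmem' _ h rfl)
      · rw [ha']; exact hna
    · exact fun p hp hp0 => hmem p (hmem' p hp hp0) hp0
    · exact le_trans (by omega) hcnt0
    · have hB : ∀ m, W'.countP (fun p => p.1.length = m) ≤ V.length * (V.length + 1) ^ (c - 1) := by
        intro m
        by_cases hm : m < c
        · exact (hbd m).trans (Nat.mul_le_mul_left _ (Nat.pow_le_pow_right (by omega) (by omega)))
        · rw [List.countP_eq_zero.2]
          · exact Nat.zero_le _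
          · intro p hp; have := hlt' p hp; simp only [decide_eq_true_eq]; omega
      have h1 := length_le_of_countP_le c W' _ hlt' hB
      have h2 : V.length * (V.length + 1) ^ (c - 1) ≤ (V.length + 1) ^ c := by
        rcases Nat.eq_zero_or_pos c with hc0 | hcpos
        · subst hc0
          have hV0 : V = [] := List.eq_nil_iff_forall_not_mem.2 fun p hp => by have := hlt p hp; omega
          subst hV0; simp
        · calc V.length * (V.length + 1) ^ (c - 1) ≤ (V.length + 1) * (V.length + 1) ^ (c - 1) :=
              Nat.mul_le_mul_right _ (Nat.le_succ _)
            _ = (V.length + 1) ^ c := by rw [← pow_succ']; congr 1; omega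
      have h3 : V.length + 1 ≤ (A + 1) * (W.length + 1) ^ E := by
        have : 1 ≤ (W.length + 1) ^ E := Nat.one_le_pow _ _ (Nat.succ_pos _)
        nlinarith
      calc W'.length ≤ c * (V.length * (V.length + 1) ^ (c - 1)) := h1
        _ ≤ c * (V.length + 1) ^ c := Nat.mul_le_mul_left _ h2
        _ ≤ c * ((A + 1) * (W.length + 1) ^ E) ^ c := Nat.mul_le_mul_left _ (Nat.pow_le_pow_left h3 c)
        _ = c * (A + 1) ^ c * (W.length + 1) ^ (E * c) := by rw [mul_pow, ← pow_mul]; ring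

end Literature.GroupTheory.Nilpotent
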